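/-
Copyright (c) 2025 Kevin Buzzard. All rights reserved.
Released under Apache 2.0 license as described in the file LICENSE.
Authors: Kevin Buzzard, Pietro Monticone
-- (for the material from `FLT/Hacks/RightActionInstances.lean`)
Copyright (c) 2025 Matthew Jasper. All rights reserved.
Released under Apache 2.0 license as described in the file LICENSE.
Authors: Matthew Jasper
-- (for the material from `FLT/Mathlib/RingTheory/TensorProduct/Basis.lean`)
Copyright (c) 2025 Kevin Buzzard. All rights reserved.
Released under Apache 2.0 license as described in the file LICENSE.
Authors: Kevin Buzzard, Salvatore Mercuri, Ruben Van de Velde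
-- (for the material from `FLT/Mathlib/Algebra/Algebra/Bilinear.lean`)

Vendored into this tree (Lean v4.32.0 / Mathlib v4.32.0) from the FLT project,
ImperialCollegeLondon/FLT @ 071d16bb51e87165b4f4b5466f14051344bf426b (2026-08-18), Apache-2.0
[FLTProject2025]. Modifications: see the module docstring ("Provenance and modifications").
-/
import Mathlib.Algebra.Lie.OfAssociative
import Mathlib.LinearAlgebra.Dimension.Finrank
import Mathlib.LinearAlgebra.Dimension.StrongRankCondition
import Mathlib.LinearAlgebra.FreeModule.StrongRankCondition
import Mathlib.LinearAlgebra.TensorProduct.Pi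
import Mathlib.RingTheory.TensorProduct.Finite
import Mathlib.RingTheory.TensorProduct.Free
import Mathlib.RingTheory.TensorProduct.Maps
import Mathlib.Topology.Algebra.Module.ModuleTopology
import Literature.NumberTheory.AdelicBaseChange.SemialgHom
import Literature.NumberTheory.AdelicBaseChange.ModuleTopologyToolkit
import HarnessLib

/-!
# Right actions on tensor products (`TensorProduct.RightActions`), bases and semialgebra homs under base change

Topic `NumberTheory/AdelicBaseChange` — file 4 of the ADELIC BASE-CHANGE PACKET (the FLT project's
proof of `L ⊗[K] K_v ≃ₐ[L] ∏_{w ∣ v} L_w`, `L ⊗[K] 𝔸_K^∞ ≃ₐ[L] 𝔸_L^∞`, `L ⊗[K] 𝔸_K ≃ₐ[L] 𝔸_L`,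
vendored module by module; Cassels–Fröhlich, *Algebraic Number Theory*, Ch. II §10, §14). Needs files
2 (`SemialgHom`) and 3 (`ModuleTopologyToolkit`).

* `TensorProduct.RightActions` (FLT's "right action hack", by design SCOPED): with the scope open,
  `M ⊗[R] A` is an `A`-module and `B ⊗[R] A` an `A`-algebra through the RIGHT factor, finite/free
  when `M` is, and — for `M` finite over `R` and `A` a topological ring — carries the `A`-MODULE
  TOPOLOGY (`IsModuleTopology A (M ⊗[R] A)`), hence is a topological group/ring, locally compact
  when `A` is. This is the topology FLT puts on `L ⊗[K] K_v` and `L ⊗[K] 𝔸_K`. Also the scoped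
  isomorphisms `Algebra.TensorProduct.comm : A ⊗[R] B ≃ₐ[A] B ⊗[R] A`, `Module.TensorProduct.comm`,
  `LinearMap.baseChange`/`LinearEquiv.baseChange`/`AlgebraMap.baseChange` on the right,
  `Algebra.TensorProduct.basis` (right version).
* `Module.Basis.rightBaseChange`: an `R`-basis of `A` gives a `B`-basis of `A ⊗[R] B`;
  `finrank_rightAlgebra : finrank B (A ⊗[R] B) = finrank R A`.
* `SemialgHom.baseChangeOfAlgebraMap ψ : S ⊗[R] A →ₐ[S] B` and
  `SemialgHom.baseChangeRightOfAlgebraMap ψ : S ⊗[R] A →ₐ[A] B` for `ψ : A →ₛₐ[algebraMap R S] B`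
  — the maps whose bijectivity IS the base-change theorem in the later files.

Everything is PROVED (definitions with bodies + lemmas); no named facts. The STATEMENTS are,
verbatim, those of the published FLT project, so every declaration carries the provenance tag
`[cite: FLTProject2025, <FLT file> · <FLT name>]` (the gate's cited-only rule for `Literature/`);
anonymous (scoped) instances carry a docstring only. The scoped instances override nothing:
they exist only inside `open scoped TensorProduct.RightActions`; Mathlib has no INSTANCE of `Module S
(M ⊗[R] S)` for a general module `M` (it does have the deliberately non-instance abbrev
`Algebra.TensorProduct.rightAlgebra : Algebra B (A ⊗[R] B)` with `right_isScalarTower`; FLT's scoped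
`Algebra S (B ⊗[R] S)` has the same `algebraMap = includeRight` but its `smul` goes through
`TensorProduct.comm`, so the two are propositionally, not reducibly, equal — review p322004), and inside
the scope the scoped `Algebra`'s `toSMul` is the scoped `SMul`, so the `Module` paths agree (FLT's own
caveat, kept in the text: with the scope open `A ⊗[R] A` is an `A`-algebra in two ways; the packet never
opens the scope in that situation). `set_option linter.dupNamespace false` is FLT's (justified in place:
the scoped copies of `Algebra.TensorProduct.comm` live in `TensorProduct.RightActions.…TensorProduct…`).

## Provenance and modifications (Apache-2.0 §4)

Lean source: `FLT/Hacks/RightActionInstances.lean`, `FLT/Mathlib/RingTheory/TensorProduct/Basis.lean`,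
`FLT/Mathlib/Algebra/Algebra/Bilinear.lean` of ImperialCollegeLondon/FLT at commit `071d16bb51e8`
(branch `main`, 2026-08-18; Lean v4.34.0-rc1 / Mathlib `274ed6d6`), concatenated in import order,
each in its own `section`. Modifications made here: (1) back-port to Mathlib v4.32.0 —
`module`/`public import`/`@[expose] public section` removed; FLT's `LinearEquiv.mulLeft`/`mulRight`
(+ `coe_mulLeft`/`coe_mulRight`) of `Bilinear.lean` OMITTED as verbatim duplicates of Mathlib's
`Units.mulLeftLinearEquiv`/`Units.mulRightLinearEquiv` (+ `Units.toLinearMap_mul{Left,Right}LinearEquiv`; review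
p322004); the two `piScalarRight` simp proofs of
`Module.Basis.rightBaseChange_repr`/`_apply` re-proved from the pin's
`Algebra.TensorProduct.piScalarRight_tmul` / `TensorProduct.piScalarRight_symm_algebraMap`
(FLT-INVENTORY §3.2 probe E rule table, 4 + 4 lines), and FLT's `IsModuleTopology.Module.topologicalRing`
(omitted from file 3 as a duplicate of Mathlib) replaced at its two uses by Mathlib's
`IsModuleTopology.isTopologicalRing`; (2) docstrings and provenance tags added to
every declaration; the original copyright headers are kept above.
NAMESPACES (CONVENTIONS §2, reviews p318962/p319167): FLT's ROOT-LEVEL declarations of this file — the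
`SemialgHom.baseChangeOfAlgebraMap` / `baseChangeRightOfAlgebraMap` family (API of the packet's
`SemialgHom`, file 2) — are declared in the path namespace `Literature.NumberTheory.AdelicBaseChange`,
which is opened at the top of this and every later packet file so that FLT's text applies unchanged;
FLT's deliberate extensions of MATHLIB namespaces — here `TensorProduct` (FLT's scoped-instance
namespace `TensorProduct.RightActions`), `Module.Basis`, `LinearEquiv` — keep their absolute names for
dot notation, and each such docstring says so. Short names are FLT's throughout, so that the later files
of the packet, and an eventual Mathlib bump absorbing FLT's upstreaming, need no renaming; none of them
exists in Mathlib v4.32.0 or in the tree.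

## References
* K. Buzzard, R. Taylor et al., *FLT* (Lean 4 project), Imperial College London, 2025–. [FLTProject2025]
-/

namespace Literature.NumberTheory.AdelicBaseChange
-- the packet namespace (CONVENTIONS §2): FLT-root declarations below live in it; it is opened here so
-- that FLT's cross-references between them and its Mathlib-namespace extensions resolve unchanged.
end Literature.NumberTheory.AdelicBaseChange

open Literature.NumberTheory.AdelicBaseChange

/-! ## From `FLT/Hacks/RightActionInstances.lean` -/

section

-- This file deliberately mirrors mathlib names such as `Algebra.TensorProduct.comm` inside
-- the `TensorProduct.RightActions` namespace, so full names duplicate `TensorProduct`.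
set_option linter.dupNamespace false

/-

# Right module and algebra instances

This file enables you to write `open scoped TensorProduct.RightActions` and magically `A ⊗[R] B`
becomes a `B`-algebra as well as an `A`-algebra, and you get instances like
`[Module.Finite R A] → [Module.Finite B (A ⊗[R] B)]`.

Perhaps even more controversially, if `B` is a commutative topological ring and an `A`-algebra,
it will put a topological module structure on `M ⊗[A] B` for `M` an `A`-module.

Mathlib would not have this hack because `A ⊗[R] A` is now an `A`-algebra in two
different ways. But this situation will not arise in the cases where we use this,
and it's very convenient to open the scope temporarily in order to prove theorems
which can be used without the scope open.
-/

namespace TensorProduct.RightActions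

noncomputable section semiring

variable (R S A B M : Type*) [CommSemiring R] [CommSemiring S] [AddCommMonoid M]
    [Algebra R S] [Module R M]
    [CommSemiring A] [Algebra R A]
    [Semiring B] [Algebra R B]

/-- Right action of a commutative semiring `S` on `M ⊗ S`. An instance only when
the `TensorProduct.RightActions` scope is open. (In Mathlib's namespace `TensorProduct.RightActions`: a deliberate extension under FLT's name, for dot notation and so that the later packet files apply unchanged — CONVENTIONS §2.) -/
scoped instance : SMul S (M ⊗[R] S) where
  smul s e := TensorProduct.comm _ _ _ (s • (TensorProduct.comm _ _ _ e))

/-- Unfolding of the scoped right scalar action: `r • m = comm.symm (r • comm m)`.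
(In Mathlib's namespace `TensorProduct.RightActions`: a deliberate extension under FLT's name, for
dot notation and so that the later packet files apply unchanged — CONVENTIONS §2.)
[cite: FLTProject2025, FLT/Hacks/RightActionInstances.lean · TensorProduct.RightActions.smul_def] -/
@[simp]
lemma smul_def (r : S) (m : M ⊗[R] S) :
    r • m = (TensorProduct.comm _ _ _).symm (r • (TensorProduct.comm _ _ _ m)) := rfl

/-- The `S`-module structure on `M ⊗ S`, when `S` is a commutative semiring.
An instance only when the `TensorProduct.RightActions` scope is open. (In Mathlib's namespace `TensorProduct.RightActions`: a deliberate extension under FLT's name, for dot notation and so that the later packet files apply unchanged — CONVENTIONS §2.) -/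
scoped instance : Module S (M ⊗[R] S) where
  one_smul x := by simp_rw [smul_def, one_smul, (TensorProduct.comm R M S).symm_apply_apply]
  mul_smul a b x := by simp_rw [smul_def, mul_smul, (TensorProduct.comm R M S).apply_symm_apply]
  smul_zero := by simp
  smul_add := by simp
  add_smul := by simp [add_smul]
  zero_smul := by simp

/-- The `S`-algebra structure on `B ⊗ S`, when `S` is a commutative semiring
and `B` is a semiring. An instance only when the `TensorProduct.RightActions` scope is open. (In Mathlib's namespace `TensorProduct.RightActions`: a deliberate extension under FLT's name, for dot notation and so that the later packet files apply unchanged — CONVENTIONS §2.) -/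
scoped instance : Algebra S (B ⊗[R] S) where
  algebraMap := Algebra.TensorProduct.includeRight.toRingHom
  commutes' s bs := by
    induction bs with
    | zero => simp only [AlgHom.toRingHom_eq_coe, RingHom.coe_coe,
      Algebra.TensorProduct.includeRight_apply, mul_zero, zero_mul]
    | tmul x y =>
        simp only [AlgHom.toRingHom_eq_coe, RingHom.coe_coe,
          Algebra.TensorProduct.includeRight_apply, Algebra.TensorProduct.tmul_mul_tmul, one_mul,
          mul_one, mul_comm]
    | add x y _ _ =>
        simp_all only [AlgHom.toRingHom_eq_coe, RingHom.coe_coe,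
          Algebra.TensorProduct.includeRight_apply, mul_add, add_mul]
  smul_def' s bs := by
    induction bs with
    | zero => simp only [smul_zero, AlgHom.toRingHom_eq_coe, RingHom.coe_coe,
      Algebra.TensorProduct.includeRight_apply, mul_zero]
    | tmul b s =>
        simp only [smul_def, TensorProduct.comm_tmul, AlgHom.toRingHom_eq_coe, RingHom.coe_coe,
          Algebra.TensorProduct.includeRight_apply, Algebra.TensorProduct.tmul_mul_tmul, one_mul]
        rw [TensorProduct.smul_tmul']
        simp only [smul_eq_mul, TensorProduct.comm_symm_tmul]
    | add x y hx hy =>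
        simp_all only [smul_def, AlgHom.toRingHom_eq_coe, RingHom.coe_coe,
          Algebra.TensorProduct.includeRight_apply, smul_add, mul_add]

/-- The structure map of the scoped right algebra structure: `algebraMap S (B ⊗[R] S) s = 1 ⊗ₜ s`.
(In Mathlib's namespace `TensorProduct.RightActions`: a deliberate extension under FLT's name, for
dot notation and so that the later packet files apply unchanged — CONVENTIONS §2.)
[cite: FLTProject2025, FLT/Hacks/RightActionInstances.lean · TensorProduct.RightActions.algebraMap_eval] -/
@[simp] lemma algebraMap_eval (s : S) : algebraMap S (B ⊗[R] S) s = 1 ⊗ₜ s := rfl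

/-- The A-algebra isomorphism A ⊗ B = B ⊗ A, available in the `TensorProduct.RightActions` scope.
(In Mathlib's namespace `TensorProduct.RightActions.Algebra.TensorProduct`: a deliberate extension
under FLT's name, for dot notation and so that the later packet files apply unchanged — CONVENTIONS §2.)
[cite: FLTProject2025, FLT/Hacks/RightActionInstances.lean · TensorProduct.RightActions.Algebra.TensorProduct.comm] -/
def Algebra.TensorProduct.comm : A ⊗[R] B ≃ₐ[A] B ⊗[R] A where
  __ := _root_.Algebra.TensorProduct.comm R A B
  commutes' _ := rfl

variable {A B} in
/-- `Algebra.TensorProduct.comm R A B (a ⊗ₜ b) = b ⊗ₜ a`.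
(In Mathlib's namespace `TensorProduct.RightActions.Algebra.TensorProduct`: a deliberate extension
under FLT's name, for dot notation and so that the later packet files apply unchanged — CONVENTIONS §2.)
[cite: FLTProject2025, FLT/Hacks/RightActionInstances.lean · TensorProduct.RightActions.Algebra.TensorProduct.comm_apply_tmul] -/
@[simp] lemma Algebra.TensorProduct.comm_apply_tmul (a : A) (b : B) :
    Algebra.TensorProduct.comm R A B (a ⊗ₜ b) = b ⊗ₜ a := by
  rfl

/-- `(Algebra.TensorProduct.comm R A B).symm (b ⊗ₜ a) = a ⊗ₜ b`.
(In Mathlib's namespace `TensorProduct.RightActions.Algebra.TensorProduct`: a deliberate extension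
under FLT's name, for dot notation and so that the later packet files apply unchanged — CONVENTIONS §2.)
[cite: FLTProject2025, FLT/Hacks/RightActionInstances.lean · TensorProduct.RightActions.Algebra.TensorProduct.comm_symm_apply_tmul] -/
@[simp] lemma Algebra.TensorProduct.comm_symm_apply_tmul (b : B) (a : A) :
    (Algebra.TensorProduct.comm R A B).symm (b ⊗ₜ a) = a ⊗ₜ b := rfl

/-- The A-module isomorphism A ⊗ M = M ⊗ A, available in the `TensorProduct.RightActions` scope.
(In Mathlib's namespace `TensorProduct.RightActions.Module.TensorProduct`: a deliberate extension
under FLT's name, for dot notation and so that the later packet files apply unchanged — CONVENTIONS §2.)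
[cite: FLTProject2025, FLT/Hacks/RightActionInstances.lean · TensorProduct.RightActions.Module.TensorProduct.comm] -/
def Module.TensorProduct.comm : A ⊗[R] M ≃ₗ[A] M ⊗[R] A where
  __ := (_root_.TensorProduct.comm R A M).toAddEquiv
  map_smul' a am := by
    induction am with
    | zero => simp only [smul_zero, AddHom.toFun_eq_coe, LinearMap.coe_toAddHom,
      map_zero, RingHom.id_apply]
    | tmul x y =>
        simp only [smul_tmul', smul_eq_mul, AddHom.toFun_eq_coe, LinearMap.coe_toAddHom,
          LinearEquiv.coe_coe, comm_tmul, RingHom.id_apply, smul_def, comm_symm_tmul]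
    | add x y hx hy =>
      simp_all only [AddHom.toFun_eq_coe, LinearMap.coe_toAddHom, LinearEquiv.coe_coe,
        RingHom.id_apply, smul_def, smul_add, map_add]

variable {A N} in
/-- `Module.TensorProduct.comm R A M (a ⊗ₜ m) = m ⊗ₜ a`.
(In Mathlib's namespace `TensorProduct.RightActions.Module.TensorProduct`: a deliberate extension
under FLT's name, for dot notation and so that the later packet files apply unchanged — CONVENTIONS §2.)
[cite: FLTProject2025, FLT/Hacks/RightActionInstances.lean · TensorProduct.RightActions.Module.TensorProduct.comm_apply_tmul] -/
@[simp] lemma Module.TensorProduct.comm_apply_tmul (a : A) (m : M) :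
    Module.TensorProduct.comm R A M (a ⊗ₜ m) = m ⊗ₜ a := rfl

/-- `(Module.TensorProduct.comm R A M).symm (m ⊗ₜ a) = a ⊗ₜ m`.
(In Mathlib's namespace `TensorProduct.RightActions.Module.TensorProduct`: a deliberate extension
under FLT's name, for dot notation and so that the later packet files apply unchanged — CONVENTIONS §2.)
[cite: FLTProject2025, FLT/Hacks/RightActionInstances.lean · TensorProduct.RightActions.Module.TensorProduct.comm_symm_apply_tmul] -/
@[simp] lemma Module.TensorProduct.comm_symm_apply_tmul (m : M) (a : A) :
    (Module.TensorProduct.comm R A M).symm (m ⊗ₜ a) = a ⊗ₜ m := rfl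

/-- `M ⊗[R] A` is a finite `A`-module (right action) when `M` is finite over `R`. Scoped instance
(`TensorProduct.RightActions`). (In Mathlib's namespace `TensorProduct.RightActions`: a deliberate extension under FLT's name, for dot notation and so that the later packet files apply unchanged — CONVENTIONS §2.) -/
scoped instance [Module.Finite R M] : Module.Finite A (M ⊗[R] A) :=
  Module.Finite.equiv (Module.TensorProduct.comm R A M)

/-- `M ⊗[R] A` is a free `A`-module (right action) when `M` is free over `R`. Scoped instance. (In Mathlib's namespace `TensorProduct.RightActions`: a deliberate extension under FLT's name, for dot notation and so that the later packet files apply unchanged — CONVENTIONS §2.) -/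
scoped instance [Module.Free R M] : Module.Free A (M ⊗[R] A) :=
  Module.Free.of_equiv (Module.TensorProduct.comm R A M)

/-- The right `A`-action on `M ⊗[R] A` is compatible with the `R`-action (`IsScalarTower R A`).
Scoped instance. (In Mathlib's namespace `TensorProduct.RightActions`: a deliberate extension under FLT's name, for dot notation and so that the later packet files apply unchanged — CONVENTIONS §2.) -/
scoped instance : IsScalarTower R A (M ⊗[R] A) where
  smul_assoc r a ma := by simp

/-- We equip `M ⊗[R] A` with the `A`-module topology if `M` is finite over `R`. (In Mathlib's namespace `TensorProduct.RightActions`: a deliberate extension under FLT's name, for dot notation and so that the later packet files apply unchanged — CONVENTIONS §2.) -/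
@[nolint unusedArguments] -- we don't need that M is a finite R-module to make this
-- definition, but I don't think I want the instance to be there in general.
scoped instance [TopologicalSpace A] [Module.Finite R M] :
    TopologicalSpace (M ⊗[R] A) :=
  moduleTopology A (M ⊗[R] A)

/-- `M ⊗[R] A` carries the `A`-module topology by definition (`IsModuleTopology`). Scoped instance. (In Mathlib's namespace `TensorProduct.RightActions`: a deliberate extension under FLT's name, for dot notation and so that the later packet files apply unchanged — CONVENTIONS §2.) -/
scoped instance [TopologicalSpace A] [Module.Finite R M] :
  IsModuleTopology A (M ⊗[R] A) := ⟨rfl⟩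

/-- Base extension of an `R`-linear map `V → W` to an `A`-linear
map `V ⊗ A → W ⊗ A`. Available in the `TensorProduct.RightActions` scope.
(In Mathlib's namespace `TensorProduct.RightActions.LinearMap`: a deliberate extension under FLT's
name, for dot notation and so that the later packet files apply unchanged — CONVENTIONS §2.)
[cite: FLTProject2025, FLT/Hacks/RightActionInstances.lean · TensorProduct.RightActions.LinearMap.baseChange] -/
noncomputable abbrev LinearMap.baseChange (R : Type*) [CommRing R]
    (V W : Type*) [AddCommGroup V] [Module R V] [AddCommGroup W] [Module R W]
    (A : Type*) [CommRing A] [Algebra R A]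
    (φ : V →ₗ[R] W) : V ⊗[R] A →ₗ[A] W ⊗[R] A :=
  (Module.TensorProduct.comm R A W) ∘ₗ
    (_root_.LinearMap.baseChange A φ) ∘ₗ
    (Module.TensorProduct.comm R A V).symm

/-- Base change of the identity is the identity: `LinearMap.baseChange R V V A .id = .id`.
(In Mathlib's namespace `TensorProduct.RightActions.LinearMap`: a deliberate extension under FLT's
name, for dot notation and so that the later packet files apply unchanged — CONVENTIONS §2.)
[cite: FLTProject2025, FLT/Hacks/RightActionInstances.lean · TensorProduct.RightActions.LinearMap.baseChange_id] -/
@[simp]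
lemma LinearMap.baseChange_id (R : Type*) [CommRing R]
    (V : Type*) [AddCommGroup V] [Module R V]
    (A : Type*) [CommRing A] [Algebra R A] :
    LinearMap.baseChange R V V A .id = .id := by
  ext
  simp

/-- Base change commutes with composition of linear maps.
(In Mathlib's namespace `TensorProduct.RightActions.LinearMap`: a deliberate extension under FLT's
name, for dot notation and so that the later packet files apply unchanged — CONVENTIONS §2.)
[cite: FLTProject2025, FLT/Hacks/RightActionInstances.lean · TensorProduct.RightActions.LinearMap.baseChange_comp] -/
theorem LinearMap.baseChange_comp (R : Type*) [CommRing R]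
    (U V W : Type*) [AddCommGroup U] [Module R U] [AddCommGroup V] [Module R V]
    [AddCommGroup W] [Module R W] (A : Type*) [CommRing A] [Algebra R A]
    (φ : U →ₗ[R] V) (ψ : V →ₗ[R] W) :
    LinearMap.baseChange R V W A ψ ∘ₗ LinearMap.baseChange R U V A φ =
    LinearMap.baseChange R U W A (ψ ∘ₗ φ) := by
  ext
  simp [_root_.LinearMap.baseChange_comp]

example (X Y) (f : X → Y) (g : Y → X) : Function.LeftInverse f g ↔ f ∘ g = id := by
  exact Function.leftInverse_iff_comp

/-- Base extension of an `R`-linear iso `V → W` to an `A`-linear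
iso `V ⊗ A → W ⊗ A`. Available in the `TensorProduct.RightActions` scope.
(In Mathlib's namespace `TensorProduct.RightActions.LinearEquiv`: a deliberate extension under
FLT's name, for dot notation and so that the later packet files apply unchanged — CONVENTIONS §2.)
[cite: FLTProject2025, FLT/Hacks/RightActionInstances.lean · TensorProduct.RightActions.LinearEquiv.baseChange] -/
noncomputable abbrev LinearEquiv.baseChange (R : Type*) [CommRing R]
    (V W : Type*) [AddCommGroup V] [Module R V] [AddCommGroup W] [Module R W]
    (A : Type*) [CommRing A] [Algebra R A]
    (φ : V ≃ₗ[R] W) : V ⊗[R] A ≃ₗ[A] W ⊗[R] A where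
  __ := LinearMap.baseChange _ _ _ _ φ.toLinearMap
  invFun := LinearMap.baseChange _ _ _ _ φ.symm.toLinearMap
  left_inv := by
    intro x
    calc
    _ = (LinearMap.baseChange R W V A φ.symm ∘ₗ LinearMap.baseChange R V W A φ) x := rfl
    _ = _ := by simp [LinearMap.baseChange_comp]
  right_inv := by
    intro y
    change ((LinearMap.baseChange R V W A φ) ∘ₗ (LinearMap.baseChange R W V A φ.symm)) y = _
    simp [LinearMap.baseChange_comp]

/-- Base extension of an `R`-algebra map `B → C` to an `A`-linear
map `B ⊗ A → C ⊗ A`. Available in the `TensorProduct.RightActions` scope.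
(In Mathlib's namespace `TensorProduct.RightActions.AlgebraMap`: a deliberate extension under FLT's
name, for dot notation and so that the later packet files apply unchanged — CONVENTIONS §2.)
[cite: FLTProject2025, FLT/Hacks/RightActionInstances.lean · TensorProduct.RightActions.AlgebraMap.baseChange] -/
noncomputable def AlgebraMap.baseChange (R : Type*) [CommRing R]
    (B C : Type*) [Ring B] [Algebra R B] [Ring C] [Algebra R C]
    (A : Type*) [CommRing A] [Algebra R A]
    (φ : B →ₐ[R] C) : B ⊗[R] A →ₐ[A] C ⊗[R] A where
  __ := Algebra.TensorProduct.map φ (.id R A)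
  commutes' a := by simp

/-- Right action version of `Algebra.TensorProduct.basis` -- base extension of a basis
over a tensor product.
(In Mathlib's namespace `TensorProduct.RightActions.Algebra.TensorProduct`: a deliberate extension
under FLT's name, for dot notation and so that the later packet files apply unchanged — CONVENTIONS §2.)
[cite: FLTProject2025, FLT/Hacks/RightActionInstances.lean · TensorProduct.RightActions.Algebra.TensorProduct.basis] -/
def Algebra.TensorProduct.basis {R : Type*} (A : Type*) {M : Type*} {ι : Type*}
    [CommSemiring R] [CommSemiring A] [Algebra R A] [AddCommMonoid M] [Module R M]
    (b : Module.Basis ι R M) :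
    Module.Basis ι A (M ⊗[R] A) :=
  (_root_.Algebra.TensorProduct.basis A b).map (Module.TensorProduct.comm R A M)

end semiring

noncomputable section ring

variable (R A B M : Type*) [CommRing R]
    [CommRing A] [Algebra R A]
    [Ring B] [Algebra R B]
    [AddCommGroup M] [Module R M]

/-- `M ⊗[R] A` with the `A`-module topology is a topological additive group. Scoped instance. (In Mathlib's namespace `TensorProduct.RightActions`: a deliberate extension under FLT's name, for dot notation and so that the later packet files apply unchanged — CONVENTIONS §2.) -/
scoped instance [TopologicalSpace A] [Module.Finite R M] :
    IsTopologicalAddGroup (M ⊗[R] A) := IsModuleTopology.topologicalAddGroup A (M ⊗[R] A)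

/-- `B ⊗[R] A` with the `A`-module topology is a topological ring when `B` is finite over `R`.
Scoped instance. (In Mathlib's namespace `TensorProduct.RightActions`: a deliberate extension under FLT's name, for dot notation and so that the later packet files apply unchanged — CONVENTIONS §2.) -/
scoped instance [TopologicalSpace A] [IsTopologicalRing A] [Module.Finite R B] :
    IsTopologicalRing (B ⊗[R] A) :=
  IsModuleTopology.isTopologicalRing A _

/-- (Duplicate of the previous scoped instance in the FLT source; kept verbatim.) (In Mathlib's namespace `TensorProduct.RightActions`: a deliberate extension under FLT's name, for dot notation and so that the later packet files apply unchanged — CONVENTIONS §2.) -/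
scoped instance [TopologicalSpace A] [IsTopologicalRing A] [Module.Finite R B] :
    IsTopologicalRing (B ⊗[R] A) :=
  IsModuleTopology.isTopologicalRing A _

/-- `M ⊗[R] A` with the `A`-module topology is locally compact when `A` is and `M` is finite over
`R`. Scoped instance. (In Mathlib's namespace `TensorProduct.RightActions`: a deliberate extension under FLT's name, for dot notation and so that the later packet files apply unchanged — CONVENTIONS §2.) -/
scoped instance [TopologicalSpace A] [IsTopologicalRing A]
    [LocallyCompactSpace A] [Module.Finite R M] :
    LocallyCompactSpace (M ⊗[R] A) := IsModuleTopology.locallyCompactSpaceOfFinite A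

end ring -- section

end TensorProduct.RightActions

end

/-! ## From `FLT/Mathlib/RingTheory/TensorProduct/Basis.lean` -/

section

section Basis

open scoped TensorProduct

open scoped TensorProduct.RightActions

variable {R : Type*} (A : Type*) {B : Type*} {ι : Type*} [CommSemiring R]
variable [CommSemiring A] [Algebra R A] [Fintype ι]
variable [CommSemiring B] [Algebra R B]

/-- The lift of an `R`-basis of `A` to a `B`-basis of the base change `A ⊗[R] B`.
(In Mathlib's namespace `Module.Basis`: a deliberate extension under FLT's name, for dot notation
and so that the later packet files apply unchanged — CONVENTIONS §2.)
[cite: FLTProject2025, FLT/Mathlib/RingTheory/TensorProduct/Basis.lean · Module.Basis.rightBaseChange] -/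
noncomputable
def Module.Basis.rightBaseChange [DecidableEq ι] (b : Module.Basis ι R A) :
    Module.Basis ι B (A ⊗[R] B) where
  repr :=
    let comm : B ⊗[R] A ≃ₗ[B] A ⊗[R] B :=
      TensorProduct.RightActions.Algebra.TensorProduct.comm R B A
    let π : B ⊗[R] A ≃ₗ[B] (ι → B) :=
      (TensorProduct.AlgebraTensorModule.congr
        (LinearEquiv.refl B B)
        b.equivFun).trans
      (TensorProduct.piScalarRight _ _ _ _)
    let finite : (ι →₀ B) ≃ₗ[B] (ι → B) := Finsupp.linearEquivFunOnFinite B B ι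
    comm.symm.trans π |>.trans finite.symm

/-- Coordinates for `Module.Basis.rightBaseChange`: the `i`-th coordinate of `b i ⊗ₜ x` is `x` (and
`0` off the diagonal), i.e. `repr (b i ⊗ₜ x) = Finsupp.single i x`.
(In Mathlib's namespace `Module.Basis`: a deliberate extension under FLT's name, for dot notation
and so that the later packet files apply unchanged — CONVENTIONS §2.)
[cite: FLTProject2025, FLT/Mathlib/RingTheory/TensorProduct/Basis.lean · Module.Basis.rightBaseChange_repr] -/
@[simp]
lemma Module.Basis.rightBaseChange_repr [DecidableEq ι] (b : Module.Basis ι R A) (i) (x : B) :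
    (b.rightBaseChange A).repr (b i ⊗ₜ x) = Finsupp.single i x := by
  have : ∑ (j : ι), (Pi.single i (1 : R) : ι → R) j • (b j) = b i := by
    conv =>
      lhs
      arg 2
      intro j
      rw [Pi.single_comm, Pi.single_apply_smul]
    simp
  rw [← LinearEquiv.eq_symm_apply]
  simp [rightBaseChange, this]

/-- The vectors of `Module.Basis.rightBaseChange b` are `b i ⊗ₜ 1`.
(In Mathlib's namespace `Module.Basis`: a deliberate extension under FLT's name, for dot notation
and so that the later packet files apply unchanged — CONVENTIONS §2.)
[cite: FLTProject2025, FLT/Mathlib/RingTheory/TensorProduct/Basis.lean · Module.Basis.rightBaseChange_apply] -/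
@[simp]
lemma Module.Basis.rightBaseChange_apply [DecidableEq ι] (b : Basis ι R A) (i) :
    b.rightBaseChange A i = b i ⊗ₜ (1 : B) := by
  rw [apply_eq_iff]
  exact rightBaseChange_repr A b i 1

end Basis

section Finrank

namespace TensorProduct

open scoped TensorProduct.RightActions

variable {R : Type*} (A : Type*) {B : Type*} [CommRing R]
  [CommSemiring A] [Algebra R A] [CommRing B] [Algebra R B] [Nontrivial B]

/-- For `A` finite free over `R`, the base change `A ⊗[R] B` has `B`-rank (right action) equal to
the `R`-rank of `A`: `finrank B (A ⊗[R] B) = finrank R A`.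
(In Mathlib's namespace `TensorProduct`: a deliberate extension under FLT's name, for dot notation
and so that the later packet files apply unchanged — CONVENTIONS §2.)
[cite: FLTProject2025, FLT/Mathlib/RingTheory/TensorProduct/Basis.lean · TensorProduct.finrank_rightAlgebra] -/
lemma finrank_rightAlgebra [Module.Finite R A] [Module.Free R A] :
    Module.finrank B (A ⊗[R] B) = Module.finrank R A := by
  have : Nontrivial R := RingHom.domain_nontrivial (algebraMap R B)
  let b := Module.Free.chooseBasis R A
  let b' : Module.Basis _ _ (A ⊗[R] B) := b.rightBaseChange A
  rw [Module.finrank_eq_card_basis b, Module.finrank_eq_card_basis b']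

end TensorProduct

end Finrank

end

/-! ## From `FLT/Mathlib/Algebra/Algebra/Bilinear.lean` -/

section

open scoped TensorProduct
variable {R S : Type*} [CommSemiring R] [CommSemiring S] {φ : R →+* S}
    {A B : Type*}

namespace Literature.NumberTheory.AdelicBaseChange

/-- Given S an R-algebra, and a ring homomorphism `ψ` from an R-algebra A to an S-algebra B
compatible with the algebra map R → S, `baseChangeOfAlgebraMap ψ` is the induced
`S`-algebra map `S ⊗[R] A → B`.
[cite: FLTProject2025, FLT/Mathlib/Algebra/Algebra/Bilinear.lean · SemialgHom.baseChangeOfAlgebraMap] -/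
noncomputable
def SemialgHom.baseChangeOfAlgebraMap [Semiring A] [Algebra R S] [Algebra R A]
    [Semiring B] [Algebra S B] (ψ : A →ₛₐ[algebraMap R S] B) :
    S ⊗[R] A →ₐ[S] B :=
  letI : Algebra R B := Algebra.compHom _ (algebraMap R S)
  have : IsScalarTower R S B := .of_algebraMap_eq fun _ ↦ rfl
  let ρ : A →ₐ[R] B := {
    toRingHom := ψ.toRingHom
    commutes' := ψ.commutes
  }
  Algebra.TensorProduct.lift (Algebra.ofId S _) ρ fun s a ↦ Algebra.commutes s (ρ a)

set_option backward.isDefEq.respectTransparency.types false in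
/-- `SemialgHom.baseChangeOfAlgebraMap ψ (s ⊗ₜ a) = s • ψ a`.
[cite: FLTProject2025, FLT/Mathlib/Algebra/Algebra/Bilinear.lean · SemialgHom.baseChange_of_algebraMap_tmul] -/
theorem SemialgHom.baseChange_of_algebraMap_tmul [Semiring A] [Algebra R S] [Algebra R A]
    [Semiring B] [Algebra S B] (ψ : A →ₛₐ[algebraMap R S] B) (s : S) (a : A) :
    ψ.baseChangeOfAlgebraMap (s ⊗ₜ[R] a) = algebraMap _ _ s * ψ a := by
  simp [baseChangeOfAlgebraMap, SemialgHom.toLinearMap_eq_coe, Algebra.ofId_apply]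

set_option backward.isDefEq.respectTransparency.types false in
/-- `SemialgHom.baseChangeOfAlgebraMap ψ (s ⊗ₜ a) = ψ a * algebraMap S B s`.
[cite: FLTProject2025, FLT/Mathlib/Algebra/Algebra/Bilinear.lean · SemialgHom.baseChange_of_algebraMap_tmul_right] -/
@[simp]
theorem SemialgHom.baseChange_of_algebraMap_tmul_right [Semiring A] [Algebra R S] [Algebra R A]
    [Semiring B] [Algebra S B] (ψ : A →ₛₐ[algebraMap R S] B) (a : A) :
    ψ.baseChangeOfAlgebraMap (1 ⊗ₜ[R] a) = ψ a := by
  simp [baseChangeOfAlgebraMap, SemialgHom.toLinearMap_eq_coe]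

set_option backward.isDefEq.respectTransparency.types false in
/-- `SemialgHom.baseChangeOfAlgebraMap ψ (s ⊗ₜ a) = algebraMap S B s * ψ a`.
[cite: FLTProject2025, FLT/Mathlib/Algebra/Algebra/Bilinear.lean · SemialgHom.baseChange_of_algebraMap_tmul_left] -/
@[simp]
theorem SemialgHom.baseChange_of_algebraMap_tmul_left [Semiring A] [Algebra R S] [Algebra R A]
    [Semiring B] [Algebra S B] (ψ : A →ₛₐ[algebraMap R S] B) (s : S) :
    ψ.baseChangeOfAlgebraMap (s ⊗ₜ[R] 1) = algebraMap _ _ s := by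
  simp [baseChangeOfAlgebraMap, SemialgHom.toLinearMap_eq_coe, Algebra.ofId_apply]

open scoped TensorProduct.RightActions in
/-- If `ψ : A →ₛₐ[algebra R S] B` and if `B` is given the `A`-algebra induced by `ψ`, then
the resulting base change map `S ⊗[R] A →ₐ[S] B` is scalar in both `S` and `A`. -/
instance [Algebra R S] [CommSemiring A] [Algebra R A] [CommSemiring B] [Algebra S B]
    (ψ : A →ₛₐ[algebraMap R S] B) :
    letI := ψ.toAlgebra
    IsBiscalar S A ψ.baseChangeOfAlgebraMap where
  __ := ψ.toAlgebra
  map_smul₁ s x := ψ.baseChangeOfAlgebraMap.map_smul_of_tower ..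
  map_smul₂ a x := by
    induction x using TensorProduct.induction_on with
    | zero => simp
    | tmul x y =>
      simp [TensorProduct.smul_tmul', -algebraMap_smul,
        algebra_compatible_smul B a, SemialgHom.baseChange_of_algebraMap_tmul,
        RingHom.algebraMap_toAlgebra, SemialgHom.toLinearMap_eq_coe]
      ring
    | add x y hx hy => simp_all

open scoped TensorProduct.RightActions in
/-- If `ψ : A →ₛₐ[algebraMap R S] B` and if `B` is given the `A`-algebra induced by `ψ`, then
the resulting base change map `S ⊗[R] A →ₐ[S] B` is scalar in both `S` and `A`.
`baseChangeRightOfAlgebraMap ψ` is the induced `A`-algebra map `S ⊗[R] A →ₐ[A] B`.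
[cite: FLTProject2025, FLT/Mathlib/Algebra/Algebra/Bilinear.lean · SemialgHom.baseChangeRightOfAlgebraMap] -/
noncomputable
def SemialgHom.baseChangeRightOfAlgebraMap [Algebra R S] [CommSemiring A] [Algebra R A]
    [CommSemiring B] [Algebra S B]
    (ψ : A →ₛₐ[algebraMap R S] B) :
    letI := ψ.toAlgebra
    S ⊗[R] A →ₐ[A] B :=
  letI := ψ.toAlgebra
  AlgHom.changeScalars A ψ.baseChangeOfAlgebraMap

open scoped TensorProduct.RightActions in
/-- `SemialgHom.baseChangeRightOfAlgebraMap ψ (s ⊗ₜ a) = s • ψ a`.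
[cite: FLTProject2025, FLT/Mathlib/Algebra/Algebra/Bilinear.lean · SemialgHom.baseChangeRightOfAlgebraMap_apply] -/
@[simp]
theorem SemialgHom.baseChangeRightOfAlgebraMap_apply [Algebra R S] [CommSemiring A] [Algebra R A]
    [CommSemiring B] [Algebra S B]
    (ψ : A →ₛₐ[algebraMap R S] B) (x : S ⊗[R] A) :
    baseChangeRightOfAlgebraMap ψ x = baseChangeOfAlgebraMap ψ x := by
  simp [baseChangeRightOfAlgebraMap, AlgHom.changeScalars_apply]

open scoped TensorProduct.RightActions in
/-- `SemialgHom.baseChangeRightOfAlgebraMap ψ` and `baseChangeOfAlgebraMap ψ` have the same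
underlying function.
[cite: FLTProject2025, FLT/Mathlib/Algebra/Algebra/Bilinear.lean · SemialgHom.baseChangeRightOfAlgebraMap_coe] -/
@[simp]
theorem SemialgHom.baseChangeRightOfAlgebraMap_coe [Algebra R S] [CommSemiring A] [Algebra R A]
    [CommSemiring B] [Algebra S B]
    (ψ : A →ₛₐ[algebraMap R S] B) :
    ⇑ψ.baseChangeRightOfAlgebraMap = ⇑ψ.baseChangeOfAlgebraMap :=
  funext_iff.2 <| ψ.baseChangeRightOfAlgebraMap_apply

end Literature.NumberTheory.AdelicBaseChange

-- (FLT's `LinearEquiv.mulLeft`/`mulRight` by a unit, with `coe_mulLeft`/`coe_mulRight`, are OMITTED: verbatim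
-- duplicates of Mathlib v4.32.0 `Units.mulLeftLinearEquiv`/`Units.mulRightLinearEquiv` with
-- `Units.toLinearMap_mulLeftLinearEquiv`/`toLinearMap_mulRightLinearEquiv` (review p322004); unused later in the packet.)

end
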